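import Literature.Computability.Cryptography.LubyRackoffHybridProofs
import Literature.Computability.Cryptography.LubyRackoffIdeal
import Literature.Computability.Cryptography.LubyRackoffIdealProofs
import HarnessLib

/-!
# Discharges of named facts of `LubyRackoff.lean`

`Literature/Computability/Cryptography/LubyRackoffHolds.lean` — proofs-only sibling of
`LubyRackoff.lean` (no definitions, no named facts). Each theorem below closes a named fact `X
: Prop` of that file as `X_holds : X` by composing an ACCEPTED reduction theorem of the tree
with the ACCEPTED unconditional `_holds` discharges of all of its hypotheses; nothing is
re-proved and no statement is changed. Recorded by the librarian sweep g25 (2026-08-16, pass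
5c: facts dischargeable in one line from the tree's own lemmas), so that the facts census,
`#h21_route_deps` and the cone guardrail see these facts as theorems.

Discharged here:

* `LubyRackoff1988_feistel3_holds` := `lubyRackoff1988_feistel3_of` `HybridStep_holds`
  `MainLemma_holds` (`LubyRackoffIdeal.lean`).

## References

* [Goldreich2001] — see `lean/references.bib` and the docstring of the fact in `LubyRackoff.lean`.
* [LubyRackoff1988] — see `lean/references.bib` and the docstring of the fact in `LubyRackoff.lean`.
-/

namespace Literature.Computability.Cryptography

/-- **Discharge of the named fact `LubyRackoff1988_feistel3`** (`LubyRackoff.lean`): Luby–Rackoff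
1988 / Goldreich 2001, Thm. 3.7.7 (pseudorandomness clause, `t = 3`), in the tree's PRP game
and about the explicit construction `feistelEnsemble`: … — obtained as
`lubyRackoff1988_feistel3_of` applied to the tree's unconditional discharges
`HybridStep_holds`, `MainLemma_holds` of its hypotheses (reduction in
`LubyRackoffIdeal.lean`).
[cite: Goldreich2001, Thm. 3.7.7 (p. 203) with Prop. 3.7.8 (pp. 203–205)]
[cite: LubyRackoff1988, abstract (main result)] -/
theorem LubyRackoff1988_feistel3_holds :
    LubyRackoff1988_feistel3 :=
  Literature.Computability.Cryptography.LubyRackoff.lubyRackoff1988_feistel3_of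
    Literature.Computability.Cryptography.LubyRackoff.HybridStep_holds
    Literature.Computability.Cryptography.LubyRackoff.MainLemma_holds

end Literature.Computability.Cryptography
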